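import Mathlib
import Literature.Analysis.FluidPDE.FlatSwirlGauge
import HarnessLib.Audit

/-!
# Crux E `PowerGaugeEulerLiouville` (stmt-NavierStokesRegularity-19832): DISCRETE SELF-SIMILARITY IN PHYSICAL VARIABLES —
# iterated scaling laws, scale-invariant sizes, the fundamental period, and the global Type-I bounds of TAME DSS members

Route `EulerZoomLiouville` (NavierStokesRegularity), crux E, width seat ns-cas-k2 (g2), key K-A″ (DSS version).  For the class
scaling `u(τ, y) = l^{1+ρ} u(l^{2+ρ}τ, l y)` (`l > 1`, `2 + ρ > 0`, time factor `T = l^{2+ρ}`, similarity exponent `n = 1/(2+ρ)`):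
* `dss_iterate` / `fderiv_dss_iterate` — the `m`-fold laws `u(τ,y) = l^{m(1+ρ)} u(Tᵐτ, lᵐy)`, `∇u(τ,y) = Tᵐ ∇u(Tᵐτ, lᵐy)`;
* `rpow_period_*` — the exponent arithmetic `(Tᵐ)^{1−n} = l^{m(1+ρ)}`, `(Tᵐ)ⁿ = lᵐ`;
* `exists_fundamental_period` — every `τ < 0` is `Tᵐ t` or satisfies `t = Tᵐ τ` for some `m : ℕ`, `t ∈ [−T, −1]`;
* `exists_typeI_of_dss_tame` — a TAME DSS velocity (`u`, `∇u` bounded on compact time intervals, the LEAD's binder of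
  `IsDSSClassicalTame`) has GLOBAL Type-I bounds `(−τ)‖∇u(τ,y)‖ ≤ K` and `(−τ)^{1−n}‖u(τ,y)‖ ≤ K` on `(−∞,0) × ℝ³`
  (periodicity: the scale-invariant sizes on `(−∞,0)` are their sizes on one period).

WHAT THIS IS NOT: not NS regularity, not the crux E — bookkeeping for hypothetical DSS blow-up members. [folklore;
ChaeTsai2014DSS-type scaling bookkeeping]
-/

noncomputable section

set_option linter.dupNamespace false

open MeasureTheory Set Filter Topology Metric Function
open scoped NNReal ENNReal ContDiff InnerProductSpace RealInnerProductSpace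

namespace Summit.NavierStokesRegularity.NavierStokesRegularity.Theorems.PowerGaugeEulerLiouville.SimilarityBernoulli

open Literature.Analysis Literature.Analysis.FluidPDE Literature.Analysis.FunctionSpaces

variable {u : ℝ → EuclideanSpace ℝ (Fin 3) → EuclideanSpace ℝ (Fin 3)} {ρ l : ℝ}

/-! ### Iterated scaling laws -/

/-- **The `m`-fold DSS law**: `u(τ, y) = (l^{1+ρ})ᵐ u((l^{2+ρ})ᵐ τ, lᵐ y)` for `τ < 0`, `m : ℕ`. [folklore] -/
theorem dss_iterate (hl : 1 < l) (hρ : 0 < 2 + ρ)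
    (hdss : ∀ τ : ℝ, τ < 0 → ∀ y, u τ y = (l ^ (1 + ρ)) • u ((l ^ (2 + ρ)) * τ) (l • y))
    (m : ℕ) {τ : ℝ} (hτ : τ < 0) (y : EuclideanSpace ℝ (Fin 3)) :
    u τ y = ((l ^ (1 + ρ)) ^ m) • u ((l ^ (2 + ρ)) ^ m * τ) (l ^ m • y) := by
  induction m generalizing τ y with
  | zero => simp
  | succ m ih =>
    have hT : 1 < l ^ (2 + ρ) := Real.one_lt_rpow hl hρ
    have hTm : 0 < (l ^ (2 + ρ)) ^ m := pow_pos (zero_lt_one.trans hT) m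
    have hτm : (l ^ (2 + ρ)) ^ m * τ < 0 := mul_neg_of_pos_of_neg hTm hτ
    rw [ih hτ y, hdss _ hτm (l ^ m • y), smul_smul, smul_smul]
    have e1 : (l ^ (1 + ρ)) ^ m * l ^ (1 + ρ) = (l ^ (1 + ρ)) ^ (m + 1) := (pow_succ _ _).symm
    have e2 : l ^ (2 + ρ) * ((l ^ (2 + ρ)) ^ m * τ) = (l ^ (2 + ρ)) ^ (m + 1) * τ := by ring
    have e3 : l * l ^ m = l ^ (m + 1) := by ring
    rw [e1, e2, e3]

/-- `l^{1+ρ} · l = l^{2+ρ}`. [folklore] -/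
theorem rpow_one_add_mul_self (hl : 0 < l) : l ^ (1 + ρ) * l = l ^ (2 + ρ) := by
  rw [← Real.rpow_add_one hl.ne']; ring_nf

/-- **The `m`-fold DSS law for the gradient**: `∇u(τ, y) = (l^{2+ρ})ᵐ ∇u((l^{2+ρ})ᵐ τ, lᵐ y)`. [folklore] -/
theorem fderiv_dss_iterate (hl : 1 < l) (hρ : 0 < 2 + ρ)
    (hdss : ∀ τ : ℝ, τ < 0 → ∀ y, u τ y = (l ^ (1 + ρ)) • u ((l ^ (2 + ρ)) * τ) (l • y))
    (m : ℕ) {τ : ℝ} (hτ : τ < 0) (y : EuclideanSpace ℝ (Fin 3)) :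
    fderiv ℝ (u τ) y = ((l ^ (2 + ρ)) ^ m) • fderiv ℝ (u ((l ^ (2 + ρ)) ^ m * τ)) (l ^ m • y) := by
  have hl0 : 0 < l := zero_lt_one.trans hl
  have hfun : u τ = fun y => ((l ^ (1 + ρ)) ^ m) • u ((l ^ (2 + ρ)) ^ m * τ) (l ^ m • y) :=
    funext fun y => dss_iterate hl hρ hdss m hτ y
  rw [hfun, fderiv_const_smul_comp_smul_apply]
  congr 1
  rw [← mul_pow, rpow_one_add_mul_self hl0]

/-! ### Exponent arithmetic for the period `T = l^{2+ρ}` and `n = 1/(2+ρ)` -/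

/-- `((l^{2+ρ})ᵐ)^{1 − 1/(2+ρ)} = (l^{1+ρ})ᵐ`. [folklore] -/
theorem rpow_period_one_sub (hl : 0 < l) (hρ : 0 < 2 + ρ) (m : ℕ) :
    ((l ^ (2 + ρ)) ^ m) ^ (1 - (2 + ρ)⁻¹) = (l ^ (1 + ρ)) ^ m := by
  rw [← Real.rpow_natCast (l ^ (2 + ρ)) m, ← Real.rpow_mul hl.le, ← Real.rpow_mul hl.le,
    ← Real.rpow_natCast (l ^ (1 + ρ)) m, ← Real.rpow_mul hl.le]
  congr 1
  field_simp
  ring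

/-- `((l^{2+ρ})ᵐ)^{1/(2+ρ)} = lᵐ`. [folklore] -/
theorem rpow_period_inv (hl : 0 < l) (hρ : 0 < 2 + ρ) (m : ℕ) :
    ((l ^ (2 + ρ)) ^ m) ^ (2 + ρ)⁻¹ = l ^ m := by
  rw [← Real.rpow_natCast (l ^ (2 + ρ)) m, ← Real.rpow_mul hl.le, ← Real.rpow_mul hl.le,
    ← Real.rpow_natCast l m]
  congr 1
  field_simp

/-- `(l^{2+ρ})ᵐ = (l^{1+ρ})ᵐ · lᵐ`. [folklore] -/
theorem period_pow_eq (hl : 0 < l) (m : ℕ) : (l ^ (2 + ρ)) ^ m = (l ^ (1 + ρ)) ^ m * l ^ m := by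
  rw [← mul_pow, rpow_one_add_mul_self hl]

/-! ### Scale-invariant sizes -/

/-- **The scaled speed is DSS-invariant**: `(−Tᵐτ)^{1−n} ‖u(Tᵐτ, lᵐy)‖ = (−τ)^{1−n} ‖u(τ, y)‖`, `n = 1/(2+ρ)`. [folklore] -/
theorem scaledSpeed_dss_iterate (hl : 1 < l) (hρ : 0 < 2 + ρ)
    (hdss : ∀ τ : ℝ, τ < 0 → ∀ y, u τ y = (l ^ (1 + ρ)) • u ((l ^ (2 + ρ)) * τ) (l • y))
    (m : ℕ) {τ : ℝ} (hτ : τ < 0) (y : EuclideanSpace ℝ (Fin 3)) :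
    (-((l ^ (2 + ρ)) ^ m * τ)) ^ (1 - (2 + ρ)⁻¹) * ‖u ((l ^ (2 + ρ)) ^ m * τ) (l ^ m • y)‖ =
      (-τ) ^ (1 - (2 + ρ)⁻¹) * ‖u τ y‖ := by
  have hl0 : 0 < l := zero_lt_one.trans hl
  have hk : 0 < (l ^ (1 + ρ)) ^ m := pow_pos (Real.rpow_pos_of_pos hl0 _) m
  have hTm : 0 ≤ (l ^ (2 + ρ)) ^ m := pow_nonneg (Real.rpow_nonneg hl0.le _) m
  have h1 : ‖u τ y‖ = (l ^ (1 + ρ)) ^ m * ‖u ((l ^ (2 + ρ)) ^ m * τ) (l ^ m • y)‖ := by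
    rw [dss_iterate hl hρ hdss m hτ y, norm_smul, Real.norm_eq_abs, abs_of_pos hk]
  rw [h1, show -((l ^ (2 + ρ)) ^ m * τ) = (l ^ (2 + ρ)) ^ m * (-τ) by ring,
    Real.mul_rpow hTm (by linarith), rpow_period_one_sub hl0 hρ m]
  ring

/-- **The scaled gradient is DSS-invariant** (as a bilinear size): `(−Tᵐτ) ∇u(Tᵐτ, lᵐy) = (−τ) ∇u(τ, y)`. [folklore] -/
theorem scaledFDeriv_dss_iterate (hl : 1 < l) (hρ : 0 < 2 + ρ)
    (hdss : ∀ τ : ℝ, τ < 0 → ∀ y, u τ y = (l ^ (1 + ρ)) • u ((l ^ (2 + ρ)) * τ) (l • y))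
    (m : ℕ) {τ : ℝ} (hτ : τ < 0) (y : EuclideanSpace ℝ (Fin 3)) :
    (-((l ^ (2 + ρ)) ^ m * τ)) • fderiv ℝ (u ((l ^ (2 + ρ)) ^ m * τ)) (l ^ m • y) = (-τ) • fderiv ℝ (u τ) y := by
  have hl0 : 0 < l := zero_lt_one.trans hl
  have hTm : (l ^ (2 + ρ)) ^ m ≠ 0 := (pow_pos (Real.rpow_pos_of_pos hl0 _) m).ne'
  rw [fderiv_dss_iterate hl hρ hdss m hτ y, smul_smul]
  congr 1
  ring

/-- **Similarity positions**: `‖lᵐ y‖ ≤ R (−Tᵐτ)ⁿ ↔ ‖y‖ ≤ R (−τ)ⁿ` (`n = 1/(2+ρ)`, `(Tᵐ)ⁿ = lᵐ`). [folklore] -/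
theorem norm_smul_le_iff_dss (hl : 1 < l) (hρ : 0 < 2 + ρ) (m : ℕ) {τ : ℝ} (hτ : τ < 0) (R : ℝ)
    (y : EuclideanSpace ℝ (Fin 3)) :
    ‖l ^ m • y‖ ≤ R * (-((l ^ (2 + ρ)) ^ m * τ)) ^ (2 + ρ)⁻¹ ↔ ‖y‖ ≤ R * (-τ) ^ (2 + ρ)⁻¹ := by
  have hl0 : 0 < l := zero_lt_one.trans hl
  have hlm : 0 < l ^ m := pow_pos hl0 m
  have hTm : 0 ≤ (l ^ (2 + ρ)) ^ m := pow_nonneg (Real.rpow_nonneg hl0.le _) m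
  rw [norm_smul, Real.norm_eq_abs, abs_of_pos hlm, show -((l ^ (2 + ρ)) ^ m * τ) = (l ^ (2 + ρ)) ^ m * (-τ) by ring,
    Real.mul_rpow hTm (by linarith), rpow_period_inv hl0 hρ m,
    show R * (l ^ m * (-τ) ^ (2 + ρ)⁻¹) = l ^ m * (R * (-τ) ^ (2 + ρ)⁻¹) by ring]
  exact ⟨fun h => le_of_mul_le_mul_left h hlm, fun h => mul_le_mul_of_nonneg_left h hlm.le⟩

/-! ### The fundamental period -/

/-- **Every past time is a period-translate of a time in `[−T, −1]`**, `T = l^{2+ρ} > 1`: for `τ < 0` there are `m : ℕ` and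
`t ∈ [−T, −1]` with `τ = Tᵐ t` (when `τ ≤ −1`) or `t = Tᵐ τ` (when `−1 < τ`). [folklore] -/
theorem exists_fundamental_period {T : ℝ} (hT : 1 < T) {τ : ℝ} (hτ : τ < 0) :
    ∃ m : ℕ, ∃ t : ℝ, t ∈ Icc (-T) (-1) ∧ (τ = T ^ m * t ∨ t = T ^ m * τ) := by
  have hT0 : 0 < T := zero_lt_one.trans hT
  obtain ⟨k, hk1, hk2⟩ := exists_mem_Ico_zpow (by linarith : 0 < -τ) hT
  -- `T^k ≤ −τ < T^{k+1}`
  rcases le_or_gt 0 k with hk | hk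
  · -- `τ = T^k · t` with `t = τ / T^k ∈ [−T, −1]`
    lift k to ℕ using hk
    have hk1' : T ^ k ≤ -τ := by exact_mod_cast hk1
    have hk2' : -τ < T ^ (k + 1) := by exact_mod_cast hk2
    have hpos : 0 < T ^ k := pow_pos hT0 k
    refine ⟨k, τ / T ^ k, ⟨?_, ?_⟩, Or.inl ?_⟩
    · rw [le_div_iff₀ hpos]
      rw [pow_succ] at hk2'
      nlinarith
    · rw [div_le_iff₀ hpos]
      linarith
    · field_simp
  · -- `k < 0`: `t = T^{−k} τ ∈ [−T, −1]`
    obtain ⟨m, hm⟩ : ∃ m : ℕ, (m : ℤ) = -k := ⟨(-k).toNat, Int.toNat_of_nonneg (by omega)⟩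
    refine ⟨m, T ^ m * τ, ⟨?_, ?_⟩, Or.inr rfl⟩
    · have h2 : -τ < T ^ (k + 1) := hk2
      have e : (T ^ m : ℝ) = T ^ (-k) := by rw [← zpow_natCast, hm]
      have e2 : T ^ (k + 1) = T * (T ^ m)⁻¹ := by
        rw [e, zpow_neg, inv_inv, zpow_add_one₀ hT0.ne', mul_comm]
      rw [e2] at h2
      have hTm : 0 < T ^ m := pow_pos hT0 m
      rw [lt_mul_inv_iff₀ hTm] at h2
      nlinarith
    · have h1 : T ^ k ≤ -τ := hk1
      have e : (T ^ m : ℝ)⁻¹ = T ^ k := by rw [← zpow_natCast, hm, zpow_neg, inv_inv]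
      have hTm : 0 < T ^ m := pow_pos hT0 m
      rw [← e, inv_le_iff_one_le_mul₀ hTm] at h1
      nlinarith

/-! ### Tame DSS velocities are globally Type I -/

/-- **TAME DSS VELOCITIES ARE GLOBALLY TYPE I**: if `u` is `l`-DSS for the class scaling (`l > 1`, `2 + ρ > 0`) and `u`, `∇u` are
bounded on `[−l^{2+ρ}, −1] × ℝ³`, then `(−τ)‖∇u(τ, y)‖ ≤ K` and `(−τ)^{1−1/(2+ρ)}‖u(τ, y)‖ ≤ K` for ALL `τ < 0`, `y`
(with `K = l^{2+ρ} B`). [folklore] -/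
theorem exists_typeI_of_dss_tame (hl : 1 < l) (hρ : 0 < 2 + ρ) (hρ1 : 0 ≤ 1 + ρ)
    (hdss : ∀ τ : ℝ, τ < 0 → ∀ y, u τ y = (l ^ (1 + ρ)) • u ((l ^ (2 + ρ)) * τ) (l • y))
    {B : ℝ} (hB : ∀ t ∈ Icc (-(l ^ (2 + ρ))) (-1), ∀ y : EuclideanSpace ℝ (Fin 3),
      ‖u t y‖ ≤ B ∧ ‖fderiv ℝ (u t) y‖ ≤ B) :
    ∀ τ : ℝ, τ < 0 → ∀ y : EuclideanSpace ℝ (Fin 3),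
      (-τ) * ‖fderiv ℝ (u τ) y‖ ≤ l ^ (2 + ρ) * B ∧ (-τ) ^ (1 - (2 + ρ)⁻¹) * ‖u τ y‖ ≤ l ^ (2 + ρ) * B := by
  have hl0 : 0 < l := zero_lt_one.trans hl
  set T : ℝ := l ^ (2 + ρ) with hT
  have hT1 : 1 < T := Real.one_lt_rpow hl hρ
  have hT0 : 0 < T := zero_lt_one.trans hT1
  have hB0 : 0 ≤ B := (norm_nonneg _).trans (hB (-1) ⟨by linarith, le_rfl⟩ 0).1
  have hn1 : 1 - (2 + ρ)⁻¹ ≤ 1 := by have := inv_pos.2 hρ; linarith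
  have hn0 : 0 ≤ 1 - (2 + ρ)⁻¹ := by
    rw [sub_nonneg, inv_le_one_iff₀]; right; linarith
  -- sizes on the fundamental period
  have hper : ∀ t ∈ Icc (-T) (-1), ∀ z : EuclideanSpace ℝ (Fin 3),
      (-t) * ‖fderiv ℝ (u t) z‖ ≤ T * B ∧ (-t) ^ (1 - (2 + ρ)⁻¹) * ‖u t z‖ ≤ T * B := by
    intro t ht z
    have h1 : -t ≤ T := by linarith [ht.1]
    have h2 : 1 ≤ -t := by linarith [ht.2]
    have hp : (-t) ^ (1 - (2 + ρ)⁻¹) ≤ T :=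
      (Real.rpow_le_rpow_of_exponent_le h2 hn1).trans (by rw [Real.rpow_one]; exact h1)
    obtain ⟨hu, hDu⟩ := hB t ht z
    exact ⟨mul_le_mul h1 hDu (norm_nonneg _) hT0.le,
      mul_le_mul hp hu (norm_nonneg _) hT0.le⟩
  intro τ hτ y
  obtain ⟨m, t, ht, hcase⟩ := exists_fundamental_period hT1 hτ
  have ht0 : t < 0 := by linarith [ht.2]
  have hTm : 0 < T ^ m := pow_pos hT0 m
  have hlm : 0 < l ^ m := pow_pos hl0 m
  rcases hcase with h | h
  · -- `τ = T^m t`: read the sizes at `(τ, y)` off `(t, l^{-m} y)`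
    set z : EuclideanSpace ℝ (Fin 3) := (l ^ m)⁻¹ • y with hz
    have hyz : l ^ m • z = y := by rw [hz, smul_smul, mul_inv_cancel₀ hlm.ne', one_smul]
    have e1 := scaledFDeriv_dss_iterate hl hρ hdss m ht0 z
    have e2 := scaledSpeed_dss_iterate hl hρ hdss m ht0 z
    rw [hyz, ← hT, ← h] at e1 e2
    have e1' : (-τ) * ‖fderiv ℝ (u τ) y‖ = (-t) * ‖fderiv ℝ (u t) z‖ := by
      have := congrArg (fun L : EuclideanSpace ℝ (Fin 3) →L[ℝ] EuclideanSpace ℝ (Fin 3) => ‖L‖) e1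
      simp only [norm_smul, Real.norm_eq_abs] at this
      rwa [abs_of_pos (by linarith : 0 < -τ), abs_of_pos (by linarith : 0 < -t)] at this
    rw [e1', e2]
    exact hper t ht z
  · -- `t = T^m τ`: read the sizes at `(τ, y)` off `(t, l^m y)`
    have e1 := scaledFDeriv_dss_iterate hl hρ hdss m hτ y
    have e2 := scaledSpeed_dss_iterate hl hρ hdss m hτ y
    rw [← hT, ← h] at e1 e2
    have e1' : (-t) * ‖fderiv ℝ (u t) (l ^ m • y)‖ = (-τ) * ‖fderiv ℝ (u τ) y‖ := by
      have := congrArg (fun L : EuclideanSpace ℝ (Fin 3) →L[ℝ] EuclideanSpace ℝ (Fin 3) => ‖L‖) e1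
      simp only [norm_smul, Real.norm_eq_abs] at this
      rwa [abs_of_pos (by linarith : 0 < -τ), abs_of_pos (by linarith : 0 < -t)] at this
    rw [← e1', ← e2]
    exact hper t ht (l ^ m • y)

end Summit.NavierStokesRegularity.NavierStokesRegularity.Theorems.PowerGaugeEulerLiouville.SimilarityBernoulli

end
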